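import Literature.MeasureTheory.RestrictedProduct.ProductMeasureRestrict
import Mathlib.Topology.Algebra.RestrictedProduct.TopologicalSpace
import Mathlib.MeasureTheory.Constructions.BorelSpace.Basic

/-!
# Restricted product measures, V: the trace σ-algebra is the Borel σ-algebra; second countability

Topic `MeasureTheory/RestrictedProduct`; continues `ProductMeasure` / `ProductMeasureRestrict`. Topology enters
here for the first time: the factors `G i` carry topologies, and Mathlib's restricted product `Πʳ i, [G i, K i]`
its restricted-product topology `RestrictedProduct.topologicalSpace` (the inductive limit of the principal
levels, Mathlib `Topology/Algebra/RestrictedProduct/TopologicalSpace`).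

* `measurableSet_of_isOpen`, `instMeasurableSpace_le_borel`, **`borelSpace`** — for countable `ι`,
  second-countable `G i` with Borel σ-algebras and measurable `K i`, the σ-algebra `instMeasurableSpace K`
  of `ProductMeasure` (the trace of the product σ-algebra) EQUALS the Borel σ-algebra of the
  restricted-product topology: so `rpMeasure` is a Borel measure for the genuine topology, and the global
  instance of `ProductMeasure` is compatible with `[BorelSpace (Πʳ i, [G i, K i])]` hypotheses;
* `secondCountableTopology` — for open `K i`, `Πʳ i, [G i, K i]` is second countable (countable open cover
  by the principal levels);
* `glue_apply_of_mem`, `glue_apply_of_not_mem` — coordinates of the gluing map `e_S`.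

Everything is proved (Mathlib only). Orientation in print: Tate's thesis, Cassels–Fröhlich (1967) Ch. XV
§3.2–§3.3 [CasselsFrohlichANT1967] (restricted direct products as locally compact groups, their measure);
J.-M. Leahy, *An introduction to Tate's thesis* (McGill 2010, doi 10.82308/51236) Prop. 3.1.8.

## Provenance

Reproduced for the tree under the LEAN-IN-TREE rule (2026-08-18) from the pub-hodgecm cell's package file
`HodgeCM/PerL34/RestrictedMeasureBorel.lean` (DAG-node prover #09 lineage, seat pv09-g2, gate run 22; 639 lines,
its datum-free content split in three here: `Borel`, `Haar`, `HaarRescale`), verbatim up to the namespace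
(`HodgeCM.PerL34.RestrictedMeasure` ↦ `Literature.MeasureTheory.RestrictedProduct`) and the added docstrings.
-/

set_option autoImplicit false

noncomputable section

open _root_.MeasureTheory Set Filter Function
open _root_.Topology

open scoped RestrictedProduct ENNReal NNReal

namespace Literature.MeasureTheory.RestrictedProduct

universe u v

variable {ι : Type u} {G : ι → Type v} [∀ i, MeasurableSpace (G i)] [∀ i, TopologicalSpace (G i)]
  (K : ∀ i, Set (G i))

omit [∀ i, MeasurableSpace (G i)] [∀ i, TopologicalSpace (G i)] in
/-- The cofinite filter is finer than the principal filter of the complement of a finite set. [folklore] -/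
theorem cofinite_le_principal_compl (S : Finset ι) :
    (cofinite : Filter ι) ≤ 𝓟 ((↑S : Set ι)ᶜ) :=
  le_principal_iff.2 (by rw [mem_cofinite, compl_compl]; exact S.finite_toSet)

/-! ## The σ-algebra is the Borel σ-algebra -/

section borel

variable [Countable ι] [∀ i, SecondCountableTopology (G i)] [∀ i, BorelSpace (G i)]

/-- Open sets of the restricted-product topology are measurable for `instMeasurableSpace K`. [folklore] -/
theorem measurableSet_of_isOpen (hKm : ∀ i, MeasurableSet (K i)) {U : Set (Πʳ i, [G i, K i])}
    (hU : IsOpen U) : MeasurableSet U := by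
  classical
  have hcov : (⋃ S : Finset ι, U ∩ rpBox K S) = U := by
    rw [← inter_iUnion]
    have h := iUnion_rpBox_union K (∅ : Finset ι)
    simp only [Finset.empty_union] at h
    rw [h, inter_univ]
  rw [← hcov]
  refine MeasurableSet.iUnion fun S => ?_
  have hS := cofinite_le_principal_compl S
  obtain ⟨V, hVo, hVeq⟩ :=
    (RestrictedProduct.isEmbedding_coe_of_principal (R := fun i => G i) (A := fun i => K i)
      (S := ((↑S : Set ι)ᶜ))).isInducing.isOpen_iff.1
      (hU.preimage (RestrictedProduct.continuous_inclusion hS))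
  have hUV : U ∩ rpBox K S = incl K ⁻¹' V ∩ rpBox K S := by
    ext x
    simp only [mem_inter_iff, mem_preimage]
    constructor
    · rintro ⟨hxU, hxB⟩
      let y : Πʳ i, [G i, K i]_[𝓟 ((↑S : Set ι)ᶜ)] :=
        ⟨fun i => x i, Filter.eventually_principal.2 fun i hi => hxB i fun h => hi (Finset.mem_coe.2 h)⟩
      have hyx : RestrictedProduct.inclusion (fun i => G i) (fun i => K i) hS y = x :=
        RestrictedProduct.ext _ _ fun _ => rfl
      have hy : y ∈ RestrictedProduct.inclusion (fun i => G i) (fun i => K i) hS ⁻¹' U := by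
        rw [mem_preimage, hyx]; exact hxU
      rw [← hVeq] at hy
      exact ⟨hy, hxB⟩
    · rintro ⟨hxV, hxB⟩
      let y : Πʳ i, [G i, K i]_[𝓟 ((↑S : Set ι)ᶜ)] :=
        ⟨fun i => x i, Filter.eventually_principal.2 fun i hi => hxB i fun h => hi (Finset.mem_coe.2 h)⟩
      have hyx : RestrictedProduct.inclusion (fun i => G i) (fun i => K i) hS y = x :=
        RestrictedProduct.ext _ _ fun _ => rfl
      have hy : y ∈ ((↑) : Πʳ i, [G i, K i]_[𝓟 ((↑S : Set ι)ᶜ)] → Π i, G i) ⁻¹' V := hxV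
      rw [hVeq, mem_preimage, hyx] at hy
      exact ⟨hy, hxB⟩
  rw [hUV]
  exact (hVo.measurableSet.preimage (measurable_incl K hKm)).inter (measurableSet_rpBox K hKm S)

omit [Countable ι] [∀ i, SecondCountableTopology (G i)] in
/-- The σ-algebra `instMeasurableSpace K` is contained in the Borel σ-algebra (the coordinate map
to the full product is continuous). [folklore] -/
theorem instMeasurableSpace_le_borel [Countable ι] [∀ i, SecondCountableTopology (G i)] :
    (instMeasurableSpace K : MeasurableSpace (Πʳ i, [G i, K i])) ≤ borel (Πʳ i, [G i, K i]) := by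
  have h := (RestrictedProduct.continuous_coe (R := fun i => G i) (A := fun i => K i)
    (𝓕 := cofinite)).borel_measurable
  rw [← (BorelSpace.measurable_eq (α := Π i, G i))] at h
  exact measurable_iff_comap_le.1 h

/-- **Borel agreement**: `instMeasurableSpace K` IS the Borel σ-algebra of the restricted-product
topology (countable `ι`, second-countable `G i`, measurable `K i`). [folklore] -/
theorem borelSpace (hKm : ∀ i, MeasurableSet (K i)) : BorelSpace (Πʳ i, [G i, K i]) :=
  ⟨le_antisymm (instMeasurableSpace_le_borel K)
    (MeasurableSpace.generateFrom_le fun _ hU => measurableSet_of_isOpen K hKm hU)⟩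

end borel

/-! ## Second countability -/

section secondCountable

variable [Countable ι] [∀ i, SecondCountableTopology (G i)]

omit [∀ i, MeasurableSpace (G i)] in
/-- For open `K i`, the restricted product of countably many second-countable spaces is second
countable (it is covered by the countably many open principal levels `A_S`). (The same statement, with
the same proof, is `Literature.NumberTheory.Automorphic.RestrictedProduct.secondCountableTopology_of_countable`
of `NumberTheory/Automorphic/AdelicSecondCountable`, found independently; it is re-proved here under the
name the downstream files of this directory use, so that this topological file does not import the adelic
ones.) [folklore] -/
theorem secondCountableTopology (hKo : ∀ i, IsOpen (K i)) :
    SecondCountableTopology (Πʳ i, [G i, K i]) := by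
  classical
  let U : Finset ι → Set (Πʳ i, [G i, K i]) := fun S =>
    Set.range (RestrictedProduct.inclusion (fun i => G i) (fun i => K i)
      (cofinite_le_principal_compl S))
  have hUo : ∀ S, IsOpen (U S) := fun S =>
    (RestrictedProduct.isOpenEmbedding_inclusion_principal hKo _).isOpen_range
  haveI hUsc : ∀ S, SecondCountableTopology (U S) := fun S => by
    haveI : SecondCountableTopology (Πʳ i, [G i, K i]_[𝓟 ((↑S : Set ι)ᶜ)]) :=
      (RestrictedProduct.isEmbedding_coe_of_principal (R := fun i => G i) (A := fun i => K i)
        (S := ((↑S : Set ι)ᶜ))).secondCountableTopology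
    exact (RestrictedProduct.isEmbedding_inclusion_principal (R := fun i => G i)
      (A := fun i => K i) (cofinite_le_principal_compl S)).toHomeomorph.symm.secondCountableTopology
  have hcov : (⋃ S, U S) = univ := by
    refine eq_univ_of_forall fun x => ?_
    have hfin : {i | ¬ (x i ∈ K i)}.Finite := Filter.eventually_cofinite.1 x.2
    refine mem_iUnion.2 ⟨hfin.toFinset, ?_⟩
    show x ∈ Set.range _
    rw [RestrictedProduct.range_inclusion]
    simp only [mem_setOf_eq, Filter.eventually_principal]
    intro i hi
    by_contra h
    exact hi (Finset.mem_coe.2 (hfin.mem_toFinset.2 h))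
  exact TopologicalSpace.secondCountableTopology_of_countable_cover hUo hcov

end secondCountable

/-! ## Coordinates of the gluing map -/

section glueApply

omit [∀ i, MeasurableSpace (G i)] [∀ i, TopologicalSpace (G i)] in
/-- Coordinates of the gluing map `e_S` at an index of `S`. [folklore] -/
theorem glue_apply_of_mem (S : Finset ι)
    (p : ((i : {i // i ∈ S}) → G i) × ((i : {i // i ∉ S}) → K i)) {i : ι} (hi : i ∈ S) :
    glue K S p i = p.1 ⟨i, hi⟩ :=
  split_symm_apply_of_mem (G := G) S _ hi

omit [∀ i, MeasurableSpace (G i)] [∀ i, TopologicalSpace (G i)] in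
/-- Coordinates of the gluing map `e_S` at an index outside `S`. [folklore] -/
theorem glue_apply_of_not_mem (S : Finset ι)
    (p : ((i : {i // i ∈ S}) → G i) × ((i : {i // i ∉ S}) → K i)) {i : ι} (hi : i ∉ S) :
    glue K S p i = (p.2 ⟨i, hi⟩ : G i) :=
  split_symm_apply_of_not_mem (G := G) S _ hi

end glueApply

end Literature.MeasureTheory.RestrictedProduct

end
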